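import Summits.NavierStokesRegularity.NavierStokesRegularity.Theses.QuantisedSymmetry
import Summits.NavierStokesRegularity.NavierStokesRegularity.Theses.Blowup
import Summits.NavierStokesRegularity.NavierStokesRegularity.Theses.FilamentSkeletonRss
import Summits.NavierStokesRegularity.NavierStokesRegularity.Theorems.QuantisedSymmetryPolyhedralTruncationBridge
import Summits.NavierStokesRegularity.NavierStokesRegularity.Theorems.QuantisedSymmetryPolyhedralDssProfileExistsDominatesBlowupProfile
import Summits.NavierStokesRegularity.NavierStokesRegularity.Theorems.QuantisedSymmetryPolyhedralDssProfileExistsStubNoSmallConstant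
import Summits.NavierStokesRegularity.NavierStokesRegularity.Theorems.FilamentSkeletonRssRdssProfileTruncation

/-!
# Strategist sketch s18-g7 (independent census, family `-s`) for crux
`QuantisedSymmetry.PolyhedralDssProfileExists` (stmt-NavierStokesRegularity-1404)

Kernel-checked probes backing `STRATEGY-CENSUS-s18.md`:

* §0  the crux ALONE decides the summit negatively (certified strengthening of the route target);
* §1  the only strictly weaker intermediate in the tree, `Blowup.BlowupTypeIDssProfile`
      (stmt-0155, no symmetry), is itself summit-bearing (W₁ → ¬S from landed theorems);
* §2  refuted strengthenings (small Type-I constant);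
* §3  three typed decompositions with their (trivial-seam) assemblies, recording which piece
      remains the whole crux / is summit-bearing on its own.

Nothing here is a new route item; this file is evidence only.
-/

set_option linter.unusedVariables false
set_option linter.dupNamespace false

namespace Summit.NavierStokesRegularity.NavierStokesRegularity.Cruxes.PolyhedralDssProfileExists.StrategistS18g7

open MeasureTheory
open Literature.Analysis.FluidPDE
open Summit.NavierStokesRegularity.NavierStokesRegularity.Theses

local notation "E3" => EuclideanSpace ℝ (Fin 3)

/-! ## §0 Certified strengthening: X⁻ alone ⇒ ¬ NavierStokesRegularity -/

/-- The crux alone refutes the summit: the two other binders of `QuantisedSymmetry.closes` are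
landed theorems (`quantisedSymmetry_polyhedralTruncationBridge_proof`, `ClayUniqueness_holds`). -/
theorem not_summit_of_crux (h : QuantisedSymmetry.PolyhedralDssProfileExists) :
    ¬ _root_.NavierStokesRegularity :=
  QuantisedSymmetry.closes h Theorems.quantisedSymmetry_polyhedralTruncationBridge_proof
    QuantisedSymmetry.ClayUniqueness_holds

/-! ## §1 Weaker intermediate W₁ = `Blowup.BlowupTypeIDssProfile` (stmt-0155) -/

/-- X⁻ → W₁ (drop the symmetry): landed as `stub_dominatesBlowupProfile`. -/
theorem w1_of_crux :
    QuantisedSymmetry.PolyhedralDssProfileExists → Blowup.BlowupTypeIDssProfile :=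
  Theorems.PolyhedralDssProfileExists.PolyhedralCell.stub_dominatesBlowupProfile

/-- W₁ → X5a (`Blowup.BlowupExists`): from the landed rotated truncation bridge
`filamentSkeletonRss_rdssProfileTruncation_proof`. -/
theorem blowupExists_of_w1 (h : Blowup.BlowupTypeIDssProfile) : Blowup.BlowupExists := by
  classical
  by_contra hne
  apply h
  intro c
  have key : ∀ R : E3 ≃ₗᵢ[ℝ] E3, RotatedTypeIDSSLiouville c R := by
    intro R hc u hanc hmeas hrdss hdec
    by_contra hnt
    exact hne (Theorems.filamentSkeletonRss_rdssProfileTruncation_proof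
      ⟨c, R, u, hc, hanc, hmeas, hrdss, hdec, hnt⟩)
  exact ⟨(rotatedTypeIDSSLiouville_refl_iff c).1 (key _), key⟩

/-- Hence W₁ is summit-bearing on its own (no symmetry needed): W₁ → ¬ NavierStokesRegularity. -/
theorem not_summit_of_w1 (h : Blowup.BlowupTypeIDssProfile) : ¬ _root_.NavierStokesRegularity :=
  Blowup.closes (blowupExists_of_w1 h) Blowup.BlowupClayUniqueness_holds

/-! ## §2 Refuted strengthening: small Type-I constant -/

/-- S⁺(small constant) is refuted: every witness of the crux has Type-I constant above an
absolute `ε` (Chae–Wolf 2017 Rem. 1.4 / §3 Step 1; landed `stub_noSmallConstant`). -/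
theorem no_small_witness :
    ∃ ε : ℝ, 0 < ε ∧ ∀ (u : ℝ → E3 → E3) (C₀ : ℝ),
      IsAncientMildSolution 1 u → (∀ t < 0, AEStronglyMeasurable (u t) volume) →
      HasTypeIDecay C₀ u → C₀ ≤ ε → ∀ t < 0, u t =ᵐ[volume] 0 :=
  Theorems.PolyhedralDssProfileExists.PolyhedralCell.stub_noSmallConstant

/-! ## §3 Typed decompositions -/

/-- The group clause of the crux. -/
def IsPolyGroup (G : Subgroup (E3 ≃ₗᵢ[ℝ] E3)) : Prop :=
  Finite G ∧ (∀ g ∈ G, LinearMap.det (g.toLinearEquiv : E3 →ₗ[ℝ] E3) = 1) ∧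
    (∀ V : Submodule ℝ E3, (∀ g ∈ G, ∀ v ∈ V, g v ∈ V) → V = ⊥ ∨ V = ⊤)

/-- The profile clause of the crux with the Type-I constant exposed. -/
def IsPolyProfile (G : Subgroup (E3 ≃ₗᵢ[ℝ] E3)) (c C₀ : ℝ) (u : ℝ → E3 → E3) : Prop :=
  IsAncientMildSolution 1 u ∧ (∀ t < 0, AEStronglyMeasurable (u t) volume) ∧
    IsDiscretelySelfSimilar c u ∧ HasTypeIDecay C₀ u ∧ (∀ g ∈ G, ∀ t x, u t (g x) = g (u t x)) ∧
      ¬ (∀ t < 0, u t =ᵐ[volume] 0)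

theorem crux_of_profile {G : Subgroup (E3 ≃ₗᵢ[ℝ] E3)} {c C₀ : ℝ} {u : ℝ → E3 → E3}
    (hG : IsPolyGroup G) (hc : 1 < c) (hu : IsPolyProfile G c C₀ u) :
    QuantisedSymmetry.PolyhedralDssProfileExists := by
  obtain ⟨hfin, hdet, hirr⟩ := hG
  obtain ⟨hanc, hmeas, hdss, hdec, heqv, hnt⟩ := hu
  exact ⟨G, hfin, hdet, hirr, c, hc, u, hanc, hmeas, hdss, ⟨C₀, hdec⟩, heqv, hnt⟩

/-! ### D1 — compactness split: almost-DSS cells + closing lemma -/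

/-- The "almost `c`-DSS cell" clause: exact `G`-equivariant Type-I ancient mild solutions, at
scale-invariant sup-distance `≤ ε` from their own `c`-rescaling, with an `L¹(B₁)` floor at `t=-1`. -/
def IsAlmostDssCell (G : Subgroup (E3 ≃ₗᵢ[ℝ] E3)) (c C₀ δ ε : ℝ) (u : ℝ → E3 → E3) : Prop :=
  IsAncientMildSolution 1 u ∧ (∀ t < 0, AEStronglyMeasurable (u t) volume) ∧ HasTypeIDecay C₀ u ∧
    (∀ g ∈ G, ∀ t x, u t (g x) = g (u t x)) ∧
    (∀ t < 0, ∀ x, Real.sqrt (-t) * ‖u t x - c • u (c ^ 2 * t) (c • x)‖ ≤ ε) ∧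
    δ ≤ ∫ x in Metric.ball (0 : E3) 1, ‖u (-1) x‖

/-- Piece D1a (the hard half): for every `ε` an almost-DSS cell with uniform constants. -/
def AlmostDssCells : Prop :=
  ∃ G, IsPolyGroup G ∧ ∃ c : ℝ, 1 < c ∧ ∃ C₀ δ : ℝ, 0 < δ ∧
    ∀ ε > 0, ∃ u : ℝ → E3 → E3, IsAlmostDssCell G c C₀ δ ε u

/-- Piece D1b (closing lemma, provable by local compactness of Type-I ancient mild solutions):
uniform almost-DSS cells have an exactly DSS nontrivial limit. -/
def DssClosing : Prop :=
  ∀ G, IsPolyGroup G → ∀ c : ℝ, 1 < c → ∀ C₀ δ : ℝ, 0 < δ →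
    (∀ ε > 0, ∃ u : ℝ → E3 → E3, IsAlmostDssCell G c C₀ δ ε u) →
      ∃ u : ℝ → E3 → E3, IsPolyProfile G c C₀ u

/-- Assembly of D1 (trivial seam). -/
theorem crux_of_D1 (ha : AlmostDssCells) (hb : DssClosing) :
    QuantisedSymmetry.PolyhedralDssProfileExists := by
  obtain ⟨G, hG, c, hc, C₀, δ, hδ, hcells⟩ := ha
  obtain ⟨u, hu⟩ := hb G hG c hc C₀ δ hδ hcells
  exact crux_of_profile hG hc hu

/-- …and the converse of the hard half: X⁻ → D1a (take the profile itself, `ε`-independent),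
modulo the `L¹(B₁)` floor which a nontrivial DSS Type-I profile has after rescaling — recorded
here only in the weaker floor-free form, which is all the census needs: D1a is not easier than X⁻. -/
theorem almostDss_of_profile {G : Subgroup (E3 ≃ₗᵢ[ℝ] E3)} {c C₀ : ℝ} {u : ℝ → E3 → E3}
    (hu : IsPolyProfile G c C₀ u) :
    ∀ ε > 0, ∀ t < 0, ∀ x, Real.sqrt (-t) * ‖u t x - c • u (c ^ 2 * t) (c • x)‖ ≤ ε := by
  intro ε hε t ht x
  obtain ⟨-, -, hdss, -, -, -⟩ := hu
  have h : c • u (c ^ 2 * t) (c • x) = u t x := by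
    have := congrArg (fun v => v t x) hdss
    simpa [nsRescale] using this
  have : u t x - c • u (c ^ 2 * t) (c • x) = 0 := by
    rw [sub_eq_zero]; exact h.symm
  simp [this, hε.le]

/-! ### D2 — Newton–Kantorovich split: (NK theorem) + (a certified frame exists) -/

/-- A Newton–Kantorovich certificate for the fixed-point problem `Φ x = x` at `x₀`, radius `ρ`,
excluding the trivial solution (`ρ < ‖x₀‖`). -/
def NKCert {E : Type} [NormedAddCommGroup E] [NormedSpace ℝ E] (Φ : E → E) (x₀ : E) (ρ : ℝ) :
    Prop :=
  ∃ (L : E →L[ℝ] E) (β K η : ℝ), 0 ≤ β ∧ 0 ≤ K ∧ 0 ≤ η ∧ 0 < ρ ∧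
    DifferentiableOn ℝ Φ (Metric.closedBall x₀ ρ) ∧
    L.comp (ContinuousLinearMap.id ℝ E - fderiv ℝ Φ x₀) = ContinuousLinearMap.id ℝ E ∧
    (ContinuousLinearMap.id ℝ E - fderiv ℝ Φ x₀).comp L = ContinuousLinearMap.id ℝ E ∧
    ‖L‖ ≤ β ∧ ‖Φ x₀ - x₀‖ ≤ η ∧
    (∀ x ∈ Metric.closedBall x₀ ρ, ∀ y ∈ Metric.closedBall x₀ ρ,
      ‖fderiv ℝ Φ x - fderiv ℝ Φ y‖ ≤ K * ‖x - y‖) ∧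
    2 * β * K * (β * η) < 1 ∧ 2 * β * η ≤ ρ ∧ ρ < ‖x₀‖

/-- Piece D2a (provable, textbook): the Newton–Kantorovich theorem for `x - Φ x = 0`. -/
def NKTheorem : Prop :=
  ∀ (E : Type) [NormedAddCommGroup E] [NormedSpace ℝ E] [CompleteSpace E]
    (Φ : E → E) (x₀ : E) (ρ : ℝ), NKCert Φ x₀ ρ → ∃ x ∈ Metric.closedBall x₀ ρ, Φ x = x

/-- Piece D2b (the hard half ⊇ X⁻ + nondegeneracy): some Banach frame `(E, Φ, ι)` whose nonzero
fixed points are polyhedral Type-I `c`-DSS profiles carries an NK certificate. Stated as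
`¬ ∀ …, ¬ …` to quantify existentially over the carrier type. -/
def CertifiedFrameExists : Prop :=
  ∃ G, IsPolyGroup G ∧ ∃ c : ℝ, 1 < c ∧ ∃ C₀ : ℝ,
    ¬ ∀ (E : Type) [NormedAddCommGroup E] [NormedSpace ℝ E] [CompleteSpace E]
        (Φ : E → E) (ι : E → ℝ → E3 → E3) (x₀ : E) (ρ : ℝ),
        ¬ ((∀ x, Φ x = x → x ≠ 0 → IsPolyProfile G c C₀ (ι x)) ∧ NKCert Φ x₀ ρ)

/-- Assembly of D2 (trivial seam). -/
theorem crux_of_D2 (hNK : NKTheorem) (hF : CertifiedFrameExists) :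
    QuantisedSymmetry.PolyhedralDssProfileExists := by
  classical
  obtain ⟨G, hG, c, hc, C₀, hframe⟩ := hF
  by_contra hX
  apply hframe
  intro E _ _ _ Φ ι x₀ ρ ⟨hsol, hcert⟩
  obtain ⟨x, hx, hfix⟩ := hNK E Φ x₀ ρ hcert
  obtain ⟨L, β, K, η, -, -, -, -, -, -, -, -, -, -, -, -, hρ⟩ := hcert
  have hx0 : x ≠ 0 := by
    intro h0
    rw [h0, Metric.mem_closedBall, dist_comm, dist_zero_right] at hx
    exact absurd (lt_of_le_of_lt hx hρ) (lt_irrefl _)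
  exact hX (crux_of_profile hG hc (hsol x hfix hx0))

/-! ### D3 — bridge split through an equivariant Leray–Hopf blow-up -/

/-- Piece D3a: a `G`-equivariant Leray–Hopf classical blow-up from a rapidly decaying datum. -/
def EquivariantBlowupExists : Prop :=
  ∃ G, IsPolyGroup G ∧ ∃ ν : ℝ, 0 < ν ∧ ∃ T : ℝ, 0 < T ∧
    ∃ (u : ℝ → E3 → E3) (p : ℝ → E3 → ℝ), IsMaximalSmoothSolution ν 0 u p T ∧
      IsLerayHopfOn T ν 0 (u 0) u ∧ HasRapidSpatialDecay (u 0) ∧ (∀ g ∈ G, ∀ t x, u t (g x) = g (u t x))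

/-- Piece D3b (open rigidity, Giga–Kohn-type "tangent flow is DSS"): such a blow-up has a
polyhedral Type-I DSS tangent profile. -/
def EquivariantTangentFlowIsDss : Prop :=
  EquivariantBlowupExists → QuantisedSymmetry.PolyhedralDssProfileExists

/-- Assembly of D3 (modus ponens)… -/
theorem crux_of_D3 (ha : EquivariantBlowupExists) (hb : EquivariantTangentFlowIsDss) :
    QuantisedSymmetry.PolyhedralDssProfileExists :=
  hb ha

/-- …but piece D3a ALREADY decides the summit on its own (violates "no piece gives S alone"). -/
theorem not_summit_of_D3a (ha : EquivariantBlowupExists) : ¬ _root_.NavierStokesRegularity := by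
  obtain ⟨G, -, ν, hν, T, hT, u, p, hmax, hLH, hdec, -⟩ := ha
  exact Blowup.closes ⟨ν, hν, T, hT, u, p, hmax, hLH, hdec⟩ Blowup.BlowupClayUniqueness_holds

end Summit.NavierStokesRegularity.NavierStokesRegularity.Cruxes.PolyhedralDssProfileExists.StrategistS18g7
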